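import Mathlib.LinearAlgebra.Eigenspace.Basic
import Mathlib.Algebra.Module.Submodule.Invariant

/-!
# Restriction of an operator to the range of a commuting map («one symmetry copy»)

Kernel-checked algebra behind step (i)(α) of the THEOREM-GRADE path of the cap seat's
P-O3-HOPF certificate (and of every class-restricted eigenpair certificate of the cell):
the certifying script works with `L` restricted to the column space of
`P = ∑ g, c g • U g`, a linear combination of symmetry operators `U g`, each of which
commutes with `L`.  The facts used are:

* a linear combination of endomorphisms commuting with `L` commutes with `L`
  (`commute_sum_smul`);
* the range of an endomorphism commuting with `L` is `L`-invariant
  (`range_mem_invtSubmodule_of_commute`, `apply_mem_range_of_commute`) — no idempotence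
  or self-adjointness of `P` is needed;
* an eigenpair of the restriction of `L` to an invariant submodule is an eigenpair of `L`
  (`apply_eq_smul_of_restrict_eq_smul`, `hasEigenvector_of_restrict`,
  `hasEigenvalue_of_restrict`).

Everything is stated for a commutative ring of scalars and an arbitrary module; the
certificates use it with `R = ℂ` on the (Galerkin or full) phase space.  MODEL/linear
bookkeeping; nothing here is specific to Navier–Stokes.
-/

namespace Summit.NavierStokesRegularity.FluidComputer.OneCopyRestriction

open Module Module.End

variable {R M : Type*} [CommRing R] [AddCommGroup M] [Module R M]

/-- A linear combination `∑ i ∈ s, c i • U i` of endomorphisms each commuting with `L`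
commutes with `L`. -/
theorem commute_sum_smul {ι : Type*} (s : Finset ι) (c : ι → R) (U : ι → End R M)
    (L : End R M) (hU : ∀ i ∈ s, Commute (U i) L) :
    Commute (∑ i ∈ s, c i • U i) L :=
  Commute.sum_left _ _ _ fun i hi => (hU i hi).smul_left (c i)

/-- If `P` commutes with `L`, then `L` maps the range of `P` into itself:
`L (P y) = P (L y)`. -/
theorem apply_mem_range_of_commute {P L : End R M} (h : Commute P L) :
    ∀ x ∈ LinearMap.range P, L x ∈ LinearMap.range P := by
  rintro x ⟨y, rfl⟩
  refine ⟨L y, ?_⟩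
  have := congrArg (fun T : End R M => T y) h.eq
  simpa [Module.End.mul_apply] using this

/-- If `P` commutes with `L`, the range of `P` is an `L`-invariant submodule
(membership in `Module.End.invtSubmodule`). -/
theorem range_mem_invtSubmodule_of_commute {P L : End R M} (h : Commute P L) :
    LinearMap.range P ∈ L.invtSubmodule :=
  (Module.End.mem_invtSubmodule_iff_forall_mem_of_mem (f := L)).2 (apply_mem_range_of_commute h)

/-- The range of a linear combination of symmetries of `L` is `L`-invariant
(the «one copy» subspace of the certificates). -/
theorem apply_mem_range_sum_smul {ι : Type*} (s : Finset ι) (c : ι → R) (U : ι → End R M)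
    (L : End R M) (hU : ∀ i ∈ s, Commute (U i) L) :
    ∀ x ∈ LinearMap.range (∑ i ∈ s, c i • U i), L x ∈ LinearMap.range (∑ i ∈ s, c i • U i) :=
  apply_mem_range_of_commute (commute_sum_smul s c U L hU)

/-- An eigen-relation for the restriction of `L` to an invariant submodule `p` is an
eigen-relation for `L` itself: `L|p v = μ v` implies `L v = μ v` in `M`. -/
theorem apply_eq_smul_of_restrict_eq_smul {L : End R M} {p : Submodule R M}
    (hp : ∀ x ∈ p, L x ∈ p) {μ : R} {v : p} (hv : L.restrict hp v = μ • v) :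
    L (v : M) = μ • (v : M) := by
  have := congrArg Subtype.val hv
  simpa [LinearMap.restrict_apply] using this

/-- An eigenvector of the restriction of `L` to an invariant submodule is an eigenvector
of `L` (same eigenvalue). -/
theorem hasEigenvector_of_restrict {L : End R M} {p : Submodule R M}
    (hp : ∀ x ∈ p, L x ∈ p) {μ : R} {v : p} (hv : HasEigenvector (L.restrict hp) μ v) :
    HasEigenvector L μ (v : M) := by
  rw [Module.End.hasEigenvector_iff] at hv ⊢
  refine ⟨?_, by simpa using hv.2⟩
  exact Module.End.eigenspace_restrict_le_eigenspace L hp μ ⟨v, hv.1, rfl⟩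

/-- An eigenvalue of the restriction of `L` to an invariant submodule is an eigenvalue
of `L`. -/
theorem hasEigenvalue_of_restrict {L : End R M} {p : Submodule R M}
    (hp : ∀ x ∈ p, L x ∈ p) {μ : R} (hμ : HasEigenvalue (L.restrict hp) μ) :
    HasEigenvalue L μ := by
  obtain ⟨v, hv⟩ := hμ.exists_hasEigenvector
  exact Module.End.hasEigenvalue_of_hasEigenvector (hasEigenvector_of_restrict hp hv)

/-- The packaged «one copy» statement: if every `U i` commutes with `L` and the
restriction of `L` to the range of `P = ∑ i ∈ s, c i • U i` has the eigenvalue `μ`, then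
`L` has the eigenvalue `μ`, with an eigenvector inside that range. -/
theorem exists_eigenvector_mem_range_of_restrict {ι : Type*} (s : Finset ι) (c : ι → R)
    (U : ι → End R M) (L : End R M) (hU : ∀ i ∈ s, Commute (U i) L) {μ : R}
    (hμ : HasEigenvalue (L.restrict (apply_mem_range_sum_smul s c U L hU)) μ) :
    ∃ w : M, w ∈ LinearMap.range (∑ i ∈ s, c i • U i) ∧ w ≠ 0 ∧ L w = μ • w := by
  obtain ⟨v, hv⟩ := hμ.exists_hasEigenvector
  have hw := hasEigenvector_of_restrict _ hv
  rw [Module.End.hasEigenvector_iff, Module.End.mem_eigenspace_iff] at hw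
  exact ⟨v, v.2, hw.2, hw.1⟩


/-! ### Conjugate eigenpairs under an antilinear symmetry (appended 2026-08-26, v2)

For a REAL operator `L` (one commuting with a conjugate-linear map `J` — stated for any
commutative star-ring `K` of scalars, used with `K = ℂ` — e.g. complex
conjugation of Fourier coefficients `û(k) ↦ conj (û(-k))`) an eigenpair `(v, μ)` yields the
eigenpair `(J v, conj μ)`; if `J` also preserves the one-copy subspace, the conjugate of a
certified complex (Hopf) eigenvalue is an eigenvalue of the same restriction.  This is the
«conjugate pair certified by symmetry» sentence of the cap seat's P-O3′-HOPF certificate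
(METHOD-O3′ §3); again pure algebra. -/

section Conjugate

variable {K V : Type*} [CommRing K] [StarRing K] [AddCommGroup V] [Module K V]

/-- If `J` is conjugate-linear and commutes with `L`, then `L v = μ • v` implies
`L (J v) = conj μ • J v`. -/
theorem apply_conj_eq_smul (L : V →ₗ[K] V) (J : V →ₛₗ[starRingEnd K] V)
    (hJ : ∀ x, J (L x) = L (J x)) {μ : K} {v : V} (hv : L v = μ • v) :
    L (J v) = (starRingEnd K μ) • J v := by
  rw [← hJ, hv, LinearMap.map_smulₛₗ]

/-- With `J` injective in addition, an eigenvector `v` of `L` for `μ` gives the eigenvector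
`J v` of `L` for `conj μ` (as `Module.End.HasEigenvector`). -/
theorem hasEigenvector_conj (L : V →ₗ[K] V) (J : V →ₛₗ[starRingEnd K] V)
    (hJ : ∀ x, J (L x) = L (J x)) (hinj : Function.Injective J) {μ : K} {v : V}
    (hv : Module.End.HasEigenvector L μ v) :
    Module.End.HasEigenvector L (starRingEnd K μ) (J v) := by
  rw [Module.End.hasEigenvector_iff] at hv ⊢
  refine ⟨?_, ?_⟩
  · rw [Module.End.mem_eigenspace_iff]
    exact apply_conj_eq_smul L J hJ (Module.End.mem_eigenspace_iff.1 hv.1)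
  · intro h0
    exact hv.2 (hinj (by rw [h0, map_zero]))

/-- Hence `conj μ` is an eigenvalue of `L` whenever `μ` is (real operators have
conjugation-symmetric point spectrum). -/
theorem hasEigenvalue_conj (L : V →ₗ[K] V) (J : V →ₛₗ[starRingEnd K] V)
    (hJ : ∀ x, J (L x) = L (J x)) (hinj : Function.Injective J) {μ : K}
    (hμ : Module.End.HasEigenvalue L μ) : Module.End.HasEigenvalue L (starRingEnd K μ) := by
  obtain ⟨v, hv⟩ := hμ.exists_hasEigenvector
  exact Module.End.hasEigenvalue_of_hasEigenvector (hasEigenvector_conj L J hJ hinj hv)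

end Conjugate


/-! ### The converse direction for EXCLUSION certificates (appended 2026-08-26, v3, cap g6)

A certificate that EXCLUDES eigenvalues (P-ONSET13-3L: a 3-L Lyapunov certificate at a negative
rate, kernel `LyapunovEigenvalueExclusion`) is computed on ONE copy `E 1 (M)` of an isotypic
component, while the census sentence is about the whole component (or the whole space). The
algebra that transports it: the component splits as `v = ∑ j, E j v` by maps `E j` commuting with
`L` (the diagonal matrix units `P_jj = (d/|G|) ∑_g ρ(g)_jj ρ(g)`), and intertwiners `T j` commuting
with `L` (the off-diagonal units `P_1j`) map copy `j` into copy `1` injectively. Then an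
eigenvector of `L` in the component yields an eigenvector of `L`, for the SAME eigenvalue, inside
copy `1` — so «no eigenvalue on copy 1» implies «no eigenvalue on the component». Pure algebra over
a commutative ring; the representation-theoretic identities (`∑ E j = P_χ`, `T j` injective on copy
`j`, everything commuting with `L`) are the instance's business. -/

section Transfer

variable {R M : Type*} [CommRing R] [AddCommGroup M] [Module R M]

/-- **Eigenvectors transfer along an injective intertwiner.** If `T` commutes with `L`,
`L v = μ • v`, and `T v ≠ 0`, then `T v` is an eigenvector of `L` for the same `μ`. -/
theorem apply_eq_smul_of_commute {T L : End R M} (hT : Commute T L) {v : M} {μ : R}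
    (hv : L v = μ • v) : L (T v) = μ • T v := by
  have h := congrArg (fun f => f v) hT.eq
  simp only [Module.End.mul_apply] at h
  rw [← h, hv, map_smul]

/-- **An eigenvector of the component has an eigen-component in some copy.** If the maps `E j`
(`j ∈ s`) commute with `L` and `∑ j ∈ s, E j v = v`, `L v = μ • v`, `v ≠ 0`, then some
`E j v ≠ 0` and it is an eigenvector of `L` for `μ`. -/
theorem exists_component_eigenvector {ι : Type*} (s : Finset ι) (E : ι → End R M) (L : End R M)
    (hE : ∀ j ∈ s, Commute (E j) L) {v : M} (hsum : ∑ j ∈ s, E j v = v) {μ : R}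
    (hv : L v = μ • v) (hv0 : v ≠ 0) : ∃ j ∈ s, E j v ≠ 0 ∧ L (E j v) = μ • E j v := by
  by_contra h
  push Not at h
  apply hv0
  rw [← hsum]
  refine Finset.sum_eq_zero fun j hj => ?_
  by_contra hj0
  exact h j hj hj0 (apply_eq_smul_of_commute (hE j hj) hv)

/-- **Transport to copy 1 («no eigenvalue on one copy ⇒ none on the component»).** With `E j`
and intertwiners `T j` all commuting with `L`, `T j` injective on the range of `E j`
(`T j (E j x) = 0 → E j x = 0`) and mapping it into a fixed submodule `p` (copy `1`), every
eigenvector `v` of `L` with `∑ j ∈ s, E j v = v` produces an eigenvector of `L` for the same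
`μ` inside `p`. Contrapositive: if `L` has no eigenvector for `μ` in `p`, it has none with
`∑ E j v = v` (none in the isotypic component). -/
theorem exists_eigenvector_mem_of_intertwiners {ι : Type*} (s : Finset ι) (E T : ι → End R M)
    (L : End R M) (hE : ∀ j ∈ s, Commute (E j) L) (hT : ∀ j ∈ s, Commute (T j) L)
    (hinj : ∀ j ∈ s, ∀ x : M, T j (E j x) = 0 → E j x = 0) (p : Submodule R M)
    (hp : ∀ j ∈ s, ∀ x : M, T j (E j x) ∈ p) {v : M} (hsum : ∑ j ∈ s, E j v = v) {μ : R}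
    (hv : L v = μ • v) (hv0 : v ≠ 0) : ∃ w ∈ p, w ≠ 0 ∧ L w = μ • w := by
  obtain ⟨j, hj, hj0, hjv⟩ := exists_component_eigenvector s E L hE hsum hv hv0
  refine ⟨T j (E j v), hp j hj v, fun h0 => hj0 (hinj j hj v h0), ?_⟩
  exact apply_eq_smul_of_commute (hT j hj) hjv

end Transfer

end Summit.NavierStokesRegularity.FluidComputer.OneCopyRestriction
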